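import Summits.BirchSwinnertonDyer.BirchSwinnertonDyer.Theses.PrintCf2
import Summits.BirchSwinnertonDyer.BirchSwinnertonDyer.Theorems.PrintCf2RamifiedOffTYZSquareSilenceSplitPrime
import HarnessLib

/-!
# Route `PrintCf2`, aside stmt-BirchSwinnertonDyer-23607 `RamifiedLowerHalfSplitPrimeOfFacts` — CLOSER BY NAME

The aside filed by planner g21 under crux stmt-BirchSwinnertonDyer-20509 / item 23431 (C⁺): the LOWER HALF of C⁺ (the split-prime family: square-free n ≡ 6 (mod 8) with a prime p ≡ 1 (mod 8) totally split in L_n(i) and harmless p-free blocks), from the named facts.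
Proved BY NAME by the cycle-13 theorem `Summit.BirchSwinnertonDyer.PrintCf2.SplitPrime.two_dvd_scriptL_of_split_prime_of_facts` of the crux LEAD (cruxlead-20509 g12).  CONDITIONAL on three named facts without `_holds`; BSD is
not proved by any of this; crux 20509 / item 23431 are NOT closed by this file.

References: [cite: TianYuanZhang2017, Thm. 1.1, §1 (p0002 L101–L110), §3 (Prop. 3.2 (1)(2), Thm. 3.5, Thm. 3.6 (1)(2), Lemma 3.18, proof of Lemma 3.21)];
[cite: Cox2013, §5.C Thm. 5.23, Cor. 5.25, §9.A]; [cite: HeathBrown1994SelmerCongruentII, §1, Appendix (Monsky)]; [cite: Darmon2004, Thm. 3.22].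
-/

set_option linter.dupNamespace false

namespace Summit.BirchSwinnertonDyer.BirchSwinnertonDyer.Theorems

/-- **Aside `RamifiedLowerHalfSplitPrimeOfFacts` (stmt-BirchSwinnertonDyer-23607), by name**: the split-prime family: square-free n ≡ 6 (mod 8) with a prime p ≡ 1 (mod 8) totally split in L_n(i) and harmless p-free blocks — the three named facts imply that every `L` with `𝓛(n)² = L²` is even, for
`ord_{s=1} L(E_n, s) = 1` and a generator `(x, y)` of `E_n(ℚ)` modulo torsion with `x ∉ {±1, ±2, ±n, ±2n}·ℚ^{×2}`.
[cite: TianYuanZhang2017, Thm. 1.1 and §3 (Prop. 3.2 (1)(2), Thm. 3.5, Thm. 3.6, Lemma 3.18, proof of Lemma 3.21)] [cite: Cox2013, §5.C Cor. 5.25, §9.A] [cite: Darmon2004, Thm. 3.22] -/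
theorem ramifiedLowerHalfSplitPrimeOfFacts_proof :
    Summit.BirchSwinnertonDyer.BirchSwinnertonDyer.Theses.PrintCf2.RamifiedLowerHalfSplitPrimeOfFacts := by
  unfold Summit.BirchSwinnertonDyer.BirchSwinnertonDyer.Theses.PrintCf2.RamifiedLowerHalfSplitPrimeOfFacts
  exact Summit.BirchSwinnertonDyer.PrintCf2.SplitPrime.two_dvd_scriptL_of_split_prime_of_facts

end Summit.BirchSwinnertonDyer.BirchSwinnertonDyer.Theorems
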